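import Literature.Probability.Process.BrownianSkeletonLaw
import Literature.MathematicalPhysics.KineticTheory.LangevinChainKernelDensity

/-!
# Crux `ExtensiveSnapshotIrreversibility` (stmt-AtomisticToContinuum-9121): the law of the skeleton

Cell decomp-a2c, lens «grading / quantitative ladder», generation 78, part S, file 1 of 4 (critic
row 1077 (d): «g78 = part S SkeletonCalculus: (I-s3) skeleton law, (I-s4) finite-dimensional
Gaussian IBP, (I-s5) refinement identity + Loewner monotonicity»).  Files 1–2 of part S are
GENERIC: they import ONLY tree files (`BrownianSkeletonLaw`, `LangevinChainKernelDensity`; file 2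
also the tree Theorems file `ParityLiouvilleSeedLiouvilleForHeatHarmonicGaussIBP`) and none of the
lineage files L–R, so they can be checked and landed on their own, at any time.  Everything here
is PROVED.

(I-s3) THE LAW OF THE SKELETON.  The level-`m` skeleton `Ξ_m = pairSkel m` of the two bath
Brownian motions (the `2·2^m` dyadic increments on `[0,1]`) has law `skelGauss m`, the product of
`2·2^m` centred Gaussians of variance `2^{-m}` (`map_pairSkel_wienerPair`; tree:
`map_dyadicIncr_brownian_eq_pi` + `nndist (dyad m (i+1)) (dyad m i) = 2^{-m}`), it is independent
of the remainder `R_m = pairRem m` (tree `indepFun_pairSkel_pairRem`), whence the joint law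
`(Ξ_m, R_m) ~ skelGauss m ⊗ law(R_m)` (`map_pairSkel_pairRem_wienerPair`), the BOCHNER
disintegration `E[Φ(Ξ_m, R_m)] = E[∫ Φ(x, R_m) d skelGauss(x)]` for integrable real `Φ`
(`integral_pairSkel_pairRem`; the tree has the `lintegral` version `lintegral_pairSkel_pairRem`
only), and almost-sure integrability of the slices `x ↦ Φ(x, R_m wp)`
(`ae_integrable_slice_pairRem`).
STEIN'S LEMMA is NOT restated in this lineage: the finite-dimensional Gaussian integration by
parts of file 2 CITES the tree's
`ParityLiouvilleSeed.HarmonicWitness.gaussian_integral_byParts` (Theorems file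
`ParityLiouvilleSeedLiouvilleForHeatHarmonicGaussIBP`: product Gaussians `⊗ᵢ N(0,vᵢ)`, Stein
identity under the three integrability hypotheses), which is exactly the shape needed — the
skeleton integrands of part T grow like `e^{C‖x‖}` (flow Jacobians) and their integrability comes
from moment bounds (leaf (SWM) of part R), not from growth classes, so the polynomial-growth
`GaussIBP.stein` of `RigorousRGSmallParameterGaussianIBP` does not serve.
No new leaves; no new instance / notation / option.
References: D. Revuz, M. Yor, Continuous Martingales and Brownian Motion (1999), Ch. I §1
(finite-dimensional laws of Brownian motion); D. Nualart, The Malliavin Calculus and Related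
Topics (2006), §1.1 (the Gaussian reference setting). [folklore]
-/

noncomputable section

namespace Summit.AtomisticToContinuum.FouriersLaw.Theorems.ExtensiveSnapshotIrreversibility.EnergyWindow

open MeasureTheory ProbabilityTheory Filter Topology Set
open scoped ENNReal NNReal
open Literature.Probability.Process Literature.MathematicalPhysics.KineticTheory.HeatConduction
open Literature.Probability.Process.KolmogorovChentsov (dyad)

/-! ## (I-s3) The law of the skeleton and the Bochner disintegration -/

section Law

variable (m : ℕ)

/-- The variance `2^{-m}` of a level-`m` dyadic increment on `[0, 1]`. [folklore] -/
def skelVar (m : ℕ) : ℝ≥0 := ((2 : ℝ≥0) ^ m)⁻¹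

/-- `skelVar m = 2^{-m}` as a real number. [folklore] -/
@[simp] theorem coe_skelVar : ((skelVar m : ℝ≥0) : ℝ) = ((2 : ℝ) ^ m)⁻¹ := by
  simp [skelVar]

/-- `2^{-m} ≠ 0`. [folklore] -/
theorem skelVar_ne_zero : skelVar m ≠ 0 := by
  simp [skelVar]

/-- The variance of a dyadic increment of level `m` is `2^{-m}`. [folklore] -/
theorem nndist_dyad_succ (i : ℕ) : nndist (dyad m (i + 1)) (dyad m i) = skelVar m := by
  apply NNReal.coe_injective
  rw [coe_nndist, NNReal.dist_eq, coe_dyad_succ_sub, abs_of_pos (by positivity), coe_skelVar,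
    one_div]

/-- **The skeleton Gaussian**: the product of `2·2^m` centred Gaussians of variance `2^{-m}` on
`PairSkeleton m = (Fin 2^m → ℝ) × (Fin 2^m → ℝ)`. [folklore] -/
abbrev skelGauss (m : ℕ) : Measure (PairSkeleton m) :=
  (Measure.pi fun _ : Fin (2 ^ m) => gaussianReal 0 (skelVar m)).prod
    (Measure.pi fun _ : Fin (2 ^ m) => gaussianReal 0 (skelVar m))

/-- The skeleton Gaussian is a probability measure. [folklore] -/
theorem isProbabilityMeasure_skelGauss : IsProbabilityMeasure (skelGauss m) := by
  infer_instance

/-- **(I-s3) The law of the skeleton of the Brownian pair is the skeleton Gaussian.**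
[folklore] -/
theorem map_pairSkel_wienerPair : wienerPair.map (pairSkel m) = skelGauss m := by
  have h1 : preWienerMeasure.map (fun (ω₁ : ℝ≥0 → ℝ) => dyadicIncr m fun u => brownian u ω₁) =
      Measure.pi fun _ : Fin (2 ^ m) => gaussianReal 0 (skelVar m) := by
    rw [map_dyadicIncr_brownian_eq_pi]
    congr 1
    funext i
    rw [nndist_dyad_succ]
  haveI := Literature.Probability.RandomPlanarGeometry.isProbabilityMeasure_preWienerMeasure'
  rw [pairSkel_eq_prodMap, wienerPair, ← Measure.map_prod_map _ _ (measurable_dyadicIncr_brownian m)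
    (measurable_dyadicIncr_brownian m), h1]

/-- **The joint law of (skeleton, remainder) is the product `skelGauss m ⊗ law(R_m)`**
(independence, tree `indepFun_pairSkel_pairRem`). [folklore] -/
theorem map_pairSkel_pairRem_wienerPair :
    wienerPair.map (fun wp => (pairSkel m wp, pairRem m wp)) =
      (skelGauss m).prod (wienerPair.map (pairRem m)) := by
  rw [← map_pairSkel_wienerPair]
  exact (indepFun_iff_map_prod_eq_prod_map_map (measurable_pairSkel m).aemeasurable
    (measurable_pairRem m).aemeasurable).1 (indepFun_pairSkel_pairRem m)

/-- The law of the remainder is a probability measure. [folklore] -/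
theorem isProbabilityMeasure_map_pairRem : IsProbabilityMeasure (wienerPair.map (pairRem m)) :=
  Measure.isProbabilityMeasure_map (measurable_pairRem m).aemeasurable

variable {m}

/-- Integrability along the driving path versus integrability against the product law.
[folklore] -/
theorem integrable_pairSkel_pairRem_iff {Φ : PairSkeleton m × WienerPair → ℝ} (hΦ : Measurable Φ) :
    Integrable (fun wp => Φ (pairSkel m wp, pairRem m wp)) wienerPair ↔
      Integrable Φ ((skelGauss m).prod (wienerPair.map (pairRem m))) := by
  rw [← map_pairSkel_pairRem_wienerPair, integrable_map_measure hΦ.aestronglyMeasurable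
    ((measurable_pairSkel m).prodMk (measurable_pairRem m)).aemeasurable]
  rfl

/-- **Bochner disintegration over the skeleton**: for an integrable real functional `Φ` of
(skeleton, remainder), `E[Φ(Ξ_m, R_m)] = E[ wp ↦ ∫ Φ(x, R_m wp) d skelGauss(x) ]`. [folklore] -/
theorem integral_pairSkel_pairRem {Φ : PairSkeleton m × WienerPair → ℝ} (hΦ : Measurable Φ)
    (hΦi : Integrable (fun wp => Φ (pairSkel m wp, pairRem m wp)) wienerPair) :
    ∫ wp, Φ (pairSkel m wp, pairRem m wp) ∂wienerPair =
      ∫ wp, ∫ x, Φ (x, pairRem m wp) ∂(skelGauss m) ∂wienerPair := by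
  haveI := isProbabilityMeasure_map_pairRem m
  have hint : Integrable Φ ((skelGauss m).prod (wienerPair.map (pairRem m))) :=
    (integrable_pairSkel_pairRem_iff hΦ).1 hΦi
  calc ∫ wp, Φ (pairSkel m wp, pairRem m wp) ∂wienerPair
      = ∫ p, Φ p ∂(wienerPair.map fun wp => (pairSkel m wp, pairRem m wp)) :=
        (integral_map ((measurable_pairSkel m).prodMk (measurable_pairRem m)).aemeasurable
          hΦ.aestronglyMeasurable).symm
    _ = ∫ p, Φ p ∂((skelGauss m).prod (wienerPair.map (pairRem m))) := by
        rw [map_pairSkel_pairRem_wienerPair]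
    _ = ∫ r, ∫ x, Φ (x, r) ∂(skelGauss m) ∂(wienerPair.map (pairRem m)) :=
        integral_prod_symm Φ hint
    _ = ∫ wp, ∫ x, Φ (x, pairRem m wp) ∂(skelGauss m) ∂wienerPair :=
        integral_map (measurable_pairRem m).aemeasurable
          (hΦ.stronglyMeasurable.integral_prod_left').aestronglyMeasurable

/-- **Almost every slice is integrable**: if `Φ(Ξ_m, R_m) ∈ L¹(wienerPair)` then for a.e. driving
path `wp` the skeleton slice `x ↦ Φ(x, R_m wp)` is `skelGauss m`-integrable. [folklore] -/
theorem ae_integrable_slice_pairRem {Φ : PairSkeleton m × WienerPair → ℝ} (hΦ : Measurable Φ)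
    (hΦi : Integrable (fun wp => Φ (pairSkel m wp, pairRem m wp)) wienerPair) :
    ∀ᵐ wp ∂wienerPair, Integrable (fun x => Φ (x, pairRem m wp)) (skelGauss m) := by
  haveI := isProbabilityMeasure_map_pairRem m
  have hint : Integrable Φ ((skelGauss m).prod (wienerPair.map (pairRem m))) :=
    (integrable_pairSkel_pairRem_iff hΦ).1 hΦi
  exact ae_of_ae_map (measurable_pairRem m).aemeasurable hint.prod_left_ae

/-- The skeleton integral of a jointly measurable functional is measurable in the remainder,
hence along the driving path. [folklore] -/
theorem measurable_integral_slice_pairRem {Φ : PairSkeleton m × WienerPair → ℝ}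
    (hΦ : Measurable Φ) :
    Measurable fun wp : WienerPair => ∫ x, Φ (x, pairRem m wp) ∂(skelGauss m) :=
  (hΦ.stronglyMeasurable.integral_prod_left').measurable.comp (measurable_pairRem m)

end Law

end Summit.AtomisticToContinuum.FouriersLaw.Theorems.ExtensiveSnapshotIrreversibility.EnergyWindow
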